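import Summits.BirchSwinnertonDyer.BirchSwinnertonDyer.Theorems.ResidualThetaTransportAtTwoThetaLayerLambdaCongruenceAtTwoCuspSpanArtinReduction
import Literature.NumberTheory.LFunctions.DedekindZeta
import HarnessLib
import Literature.NumberTheory.Multiplicative.ArtinPrimitiveRootProgressions

/-!
# Route `ResidualThetaTransportAtTwo`, node (G′)_N = `CuspSpanEvenAtTwo N` (item 27436; cruxes Kan⁺ 20688 / Kμ⁺ 20689 / 21437):
# the node, the route item and Kan⁺ UNDER THE EXTENDED RIEMANN HYPOTHESIS (+ the printed Hooley–Lenstra–Moree theorem)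

Cell `bsd-wall`, extra width seat `bsd-wall-rtt-p3-w5` g0 (2026-08-28); helper `--supports stmt-BirchSwinnertonDyer-20688`; BSD is not
proved by this. Sequel of `…CuspSpanArtinReduction` (p630531): there the node is derived from the inline arithmetic hypothesis (AP₃) «Artin
primes for the base `2` in every progression `r (mod M)`, `8 ∣ M`, `r ≡ 3 (mod 8)`». Here (AP₃) is supplied by the PRINTED theorem of
Hooley–Lenstra–Moree, which proves it under the Generalized Riemann Hypothesis for the Dedekind zeta functions of the Kummer fields
`ℚ(ζ_M, ζ_n, 2^{1/n})` — a consequence of the tree's registered open statement `Literature.NumberTheory.LFunctions.ExtendedRiemannHypothesis`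
(ERH for every number field). The printed theorem is recorded as ONE named fact of the shape «ERH → (AP₃)» (Literature debt, dischargeable by
porting Lenstra 1977 §§3–8 / Moree 1999 §§2–4; not research), and the node / the route item 27436 / Kan⁺ follow CONDITIONALLY ON ERH.

* `lenstra1977_exists_prime_two_primitiveRoot_progression_of_ERH` — the named fact (Lenstra 1977 Thm. (8.3); Moree 1999 Thm. 2: under GRH the
  primes `q ≡ r (mod M)` with `2` a primitive root have density `2·A(r, M, 1)/φ(M) > 0` when `8 ∣ M`, `(2/r) = −1`; Thm. 4: the density
  vanishes iff `8 ∣ M ∧ (2/r) = +1`).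
* `artinProgression_of_ERH`, `cuspSpanEvenAtTwo_of_ERH`, `cuspSpanEvenAtTwoOdd_of_ERH`, `thetaLayerLambdaCongruenceAtTwo_of_pub_of_ERH`,
  `signedMuAnalyticAtTwoPlus_of_abbesUllmo_of_artin` / `_of_ERH` — (AP₃) from ERH + the named fact; the node at every odd level, the route
  item 27436 by name, Kan⁺ from the PUB⁵ bundle, and the analytic child 21437 from Abbes–Ullmo, each GRANTED the named fact and
  `ExtendedRiemannHypothesis` (FLAT for the habitat: feed `forall_cuspSpanEvenAtTwo_of_artin` to `flatMuZeroAtTwo_of_forall_cuspSpanEvenAtTwo`;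
  TP2 K1: to `MazurTateCongruenceAtTwoR.mazurTateCongruenceAtTwoTop_of_fiveFacts_cuspSpan`).

Nothing is asserted: ERH is an open conjecture (registered `@[conjecture]` statement), the named fact is print; no item is closed.

References: C. Hooley, J. reine angew. Math. 225 (1967) 209–220 [Hooley1967]; H. W. Lenstra, Invent. Math. 42 (1977) 201–224 [Lenstra1977];
P. Moree, J. Number Theory 78 (1999) 85–98 [Moree1999]; R. Pollack, Duke Math. J. 118 (2003) Conj. 6.3 [Pollack2003].
-/

set_option autoImplicit false
set_option linter.dupNamespace false

noncomputable section

open scoped MatrixGroups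

open CongruenceSubgroup

namespace Summit.BirchSwinnertonDyer.BirchSwinnertonDyer.Theorems.SignedMuAtTwo

/-- ERH and the printed Hooley–Lenstra–Moree theorem give the hypothesis (AP₃) of `…CuspSpanArtinReduction` in its «every non-zero
residue is a power of `2`» form. [cite: Lenstra1977, Thm. (8.3)] [cite: Moree1999, Thm. 2] [cite: HardyWright2008, §9.6 (Thm. 139)] -/
theorem artinProgression_of_ERH
    (hLM : Literature.NumberTheory.Multiplicative.lenstra1977_exists_prime_two_primitiveRoot_progression_of_ERH)
    (hERH : Literature.NumberTheory.LFunctions.ExtendedRiemannHypothesis) :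
    ∀ (M r B : ℕ), 8 ∣ M → r % 8 = 3 → Nat.Coprime r M →
      ∃ q : ℕ, q.Prime ∧ B < q ∧ q ≡ r [MOD M] ∧ ∀ x : ZMod q, x ≠ 0 → ∃ i : ℕ, (2 : ZMod q) ^ i = x := by
  intro M r B hM hr hrM
  obtain ⟨q, hq, hB, hqr, hroot⟩ := hLM hERH M r B hM hr hrM
  exact ⟨q, hq, hB, hqr, ArtinRoute.exists_two_pow_eq_of_orderOf hq hroot⟩

/-- **(G′)_N at every odd level under ERH** (granted the printed Hooley–Lenstra–Moree theorem): `CuspSpanEvenAtTwo N` for odd `N`.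
[cite: Lenstra1977, Thm. (8.3)] [cite: Moree1999, Thm. 2] [cite: Pollack2003, Conj. 6.3] -/
theorem cuspSpanEvenAtTwo_of_ERH
    (hLM : Literature.NumberTheory.Multiplicative.lenstra1977_exists_prime_two_primitiveRoot_progression_of_ERH)
    (hERH : Literature.NumberTheory.LFunctions.ExtendedRiemannHypothesis)
    (N : ℕ) [NeZero N] (hN : Odd N) : CuspSpanEvenAtTwo N :=
  cuspSpanEvenAtTwo_of_artin (artinProgression_of_ERH hLM hERH) N hN

/-- **The route item 27436 `CuspSpanEvenAtTwoOdd` under ERH** (granted the printed Hooley–Lenstra–Moree theorem). Conditional result;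
the item is not closed by this. [cite: Lenstra1977, Thm. (8.3)] [cite: Moree1999, Thm. 2 and Thm. 4] [cite: Pollack2003, Conj. 6.3] -/
theorem cuspSpanEvenAtTwoOdd_of_ERH
    (hLM : Literature.NumberTheory.Multiplicative.lenstra1977_exists_prime_two_primitiveRoot_progression_of_ERH)
    (hERH : Literature.NumberTheory.LFunctions.ExtendedRiemannHypothesis) :
    Summit.BirchSwinnertonDyer.BirchSwinnertonDyer.Theses.ResidualThetaTransportAtTwo.CuspSpanEvenAtTwoOdd :=
  cuspSpanEvenAtTwoOdd_of_artin (artinProgression_of_ERH hLM hERH)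

/-- **Kan⁺ `ThetaLayerLambdaCongruenceAtTwo` (crux 20688) from the PUB⁵ bundle `PublishedInputsHeckeAtTwo`, under ERH** (granted the
printed Hooley–Lenstra–Moree theorem), through the landed glue 27454. Conditional; nothing is closed by this.
[cite: Lenstra1977, Thm. (8.3)] [cite: Pollack2003, Conj. 6.3] -/
theorem thetaLayerLambdaCongruenceAtTwo_of_pub_of_ERH
    (hPub : Summit.BirchSwinnertonDyer.BirchSwinnertonDyer.Theses.ResidualThetaTransportAtTwo.PublishedInputsHeckeAtTwo)
    (hLM : Literature.NumberTheory.Multiplicative.lenstra1977_exists_prime_two_primitiveRoot_progression_of_ERH)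
    (hERH : Literature.NumberTheory.LFunctions.ExtendedRiemannHypothesis) :
    Summit.BirchSwinnertonDyer.BirchSwinnertonDyer.Theses.ResidualThetaTransportAtTwo.ThetaLayerLambdaCongruenceAtTwo :=
  thetaLayerLambdaCongruenceAtTwo_of_pub_of_artin hPub (artinProgression_of_ERH hLM hERH)

/-- **The analytic child 21437 `SignedMuAnalyticAtTwoPlus` from Abbes–Ullmo Thm. A (by name) and (AP₃)** (rtt-p4's closer
`signedMuAnalyticAtTwoPlus_of_abbesUllmo_of_forall_cuspSpanEvenAtTwo` fed with `forall_cuspSpanEvenAtTwo_of_artin`). Conditional.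
[cite: Lenstra1977, Thm. (8.3)] [cite: Pollack2003, Conj. 6.3] -/
theorem signedMuAnalyticAtTwoPlus_of_abbesUllmo_of_artin
    (hAU : Literature.NumberTheory.EllipticCurves.ModularForms.abbesUllmo_not_dvd_maninConstant_of_not_dvd_level)
    (hAP : ∀ (M r B : ℕ), 8 ∣ M → r % 8 = 3 → Nat.Coprime r M →
      ∃ q : ℕ, q.Prime ∧ B < q ∧ q ≡ r [MOD M] ∧ ∀ x : ZMod q, x ≠ 0 → ∃ i : ℕ, (2 : ZMod q) ^ i = x) :
    Summit.BirchSwinnertonDyer.BirchSwinnertonDyer.Theses.ResidualThetaTransportAtTwo.SignedMuAnalyticAtTwoPlus :=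
  signedMuAnalyticAtTwoPlus_of_abbesUllmo_of_forall_cuspSpanEvenAtTwo hAU (forall_cuspSpanEvenAtTwo_of_artin hAP)

/-- **The analytic child 21437 under ERH** (Abbes–Ullmo + Hooley–Lenstra–Moree by name). Conditional. [cite: Lenstra1977, Thm. (8.3)]
[cite: Pollack2003, Conj. 6.3] -/
theorem signedMuAnalyticAtTwoPlus_of_abbesUllmo_of_ERH
    (hAU : Literature.NumberTheory.EllipticCurves.ModularForms.abbesUllmo_not_dvd_maninConstant_of_not_dvd_level)
    (hLM : Literature.NumberTheory.Multiplicative.lenstra1977_exists_prime_two_primitiveRoot_progression_of_ERH)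
    (hERH : Literature.NumberTheory.LFunctions.ExtendedRiemannHypothesis) :
    Summit.BirchSwinnertonDyer.BirchSwinnertonDyer.Theses.ResidualThetaTransportAtTwo.SignedMuAnalyticAtTwoPlus :=
  signedMuAnalyticAtTwoPlus_of_abbesUllmo_of_artin hAU (artinProgression_of_ERH hLM hERH)

end Summit.BirchSwinnertonDyer.BirchSwinnertonDyer.Theorems.SignedMuAtTwo

end
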